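import Summits.CriticalPhenomena.CardyFormulaZ2.Theorems.CardyMagicRigidityMarkovCascadeDefs
import Summits.CriticalPhenomena.CardyFormulaZ2.Theorems.CardyMagicRigidityNestingRigidityIsCloseReduction
import Summits.CriticalPhenomena.CardyFormulaZ2.Theorems.CardyMagicRigidityNestingRigidityBondLoopDensity
import Literature.Probability.Percolation.SiteLoopDensity
import HarnessLib

/-!
# Law-level `d_CN` reduction to the matching of big loops

Helper toward crux `NestingRigidity` (stmt-CriticalPhenomena-4835), line `markov-cascade-one-generation`,
stub `cnLawEDist_le_of_bigLoops_matched`: for every `ε > 0` and all small meshes `δ`, ANY coupling `Q`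
of `P2` and `PT` under which the big loops (diameter `≥ ε/8`, trace in the window `B(0, 1/ε)`) of
`bondLoopConfig δ 0 p.1` and `siteLoopConfig δ p.2` are matched, type by type and in both
directions, within `udist ≤ ε` off an event of `Q`-measure `< ε/2`, witnesses
`cnLawEDist P2 (bondLoopConfig δ 0) PT (siteLoopConfig δ) ≤ ε`.

Proof: by the deterministic reduction `isClose_of_dense_of_forall_big` the bad event
`{¬ IsClose ε}` is contained in `BigUnmatched ∪ fst ⁻¹' SparseZ2 ∪ snd ⁻¹' SparseT`, where
`Sparse#` is the failure of `ε/4`-density of one type on the closed ball of radius `1/ε`; the two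
density events have marginal probability `< ε/4` for all small `δ`
(`tendsto_measure_setOf_sparse_bondLoopConfig`, `tendsto_measure_setOf_sparse_siteLoopConfig`),
and `Q (fst ⁻¹' A) ≤ P2 A`, `Q (snd ⁻¹' B) ≤ PT B` for every set (`Measure.le_map_apply`), so
`Q {¬ IsClose ε} < ε/2 + ε/4 + ε/4 = ε` and `cnLawEDist_le_of_coupling` concludes.
-/

noncomputable section

open MeasureTheory Set Filter
open scoped Topology BigOperators ENNReal Real

namespace Summit.CriticalPhenomena.CardyFormulaZ2.Cruxes.NestingRigidity.MarkovCascadeOneGeneration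

open Literature.Probability.RandomPlanarGeometry Literature.Probability.Percolation
  Literature.Probability.LatticeModels
open Summit.CriticalPhenomena.CardyFormulaZ2.Theses.CardyMagicRigidity

/-- Deterministic set-level reduction: if `d_CN(c, c') ≤ ε` fails then either some big loop
(diameter `≥ ε/8`, trace in the window) of one configuration has no same-type partner at
`udist ≤ ε` in the other, or one of the two configurations is not `ε/4`-dense (for some type) at
some point of the closed ball of radius `1/ε`. [folklore] -/
theorem bigUnmatched_or_sparse_of_not_isClose {ε : ℝ} (hε : 0 < ε) {c c' : LoopConfig ℂ}
    (h : ¬ LoopConfig.IsClose ε c c') :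
    (∃ i : Fin 2,
      (∃ u ∈ c.F i, u.range ⊆ Metric.ball (0 : ℂ) (1 / ε) ∧ ε / 8 ≤ Metric.diam u.range ∧
        ∀ u' ∈ c'.F i, ε < u.udist u') ∨
      (∃ u' ∈ c'.F i, u'.range ⊆ Metric.ball (0 : ℂ) (1 / ε) ∧ ε / 8 ≤ Metric.diam u'.range ∧
        ∀ u ∈ c.F i, ε < u'.udist u)) ∨
    (∃ z ∈ Metric.closedBall (0 : ℂ) (1 / ε), ∃ i : Fin 2,
      ∀ u ∈ c.F i, ¬ u.range ⊆ Metric.ball z (ε / 4)) ∨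
    (∃ z ∈ Metric.closedBall (0 : ℂ) (1 / ε), ∃ i : Fin 2,
      ∀ u' ∈ c'.F i, ¬ u'.range ⊆ Metric.ball z (ε / 4)) := by
  by_contra hnot
  simp only [not_or, not_exists, not_and, not_forall, not_not, not_lt] at hnot
  obtain ⟨hbig, hdense, hdense'⟩ := hnot
  refine h (isClose_of_dense_of_forall_big hε ?_ ?_ ?_)
  · intro z hz i
    have hz' : z ∈ Metric.closedBall (0 : ℂ) (1 / ε) := Metric.ball_subset_closedBall hz
    obtain ⟨u, hu, hur⟩ := hdense z hz' i
    obtain ⟨u', hu', hu'r⟩ := hdense' z hz' i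
    exact ⟨⟨u, hu, hur⟩, ⟨u', hu', hu'r⟩⟩
  · intro i u hu hw hd
    obtain ⟨u', hu', hle⟩ := (hbig i).1 u hu hw hd
    exact ⟨u', hu', hle⟩
  · intro i u' hu' hw hd
    obtain ⟨u, hu, hle⟩ := (hbig i).2 u' hu' hw hd
    exact ⟨u, hu, hle⟩

/-- **Law-level `d_CN` reduction to the matching of big loops.** For every `ε > 0` and all small
meshes `δ`, any coupling `Q` of `P2` and `PT` under which the loops of diameter `≥ ε/8` with trace in
the window `B(0, 1/ε)` of `bondLoopConfig δ 0 p.1` and of `siteLoopConfig δ p.2` are matched, type by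
type and in both directions, within `udist ≤ ε` off an event of `Q`-measure `< ε/2`, witnesses
`cnLawEDist P2 (bondLoopConfig δ 0) PT (siteLoopConfig δ) ≤ ε`: the small loops are matched for free by
the density of microscopic loops of both types on both lattices
(`tendsto_measure_setOf_sparse_bondLoopConfig`, `tendsto_measure_setOf_sparse_siteLoopConfig`) and the
deterministic reduction `isClose_of_dense_of_forall_big`. [folklore] -/
theorem cnLawEDist_le_of_bigLoops_matched : ∀ {ε : ℝ}, 0 < ε → ∀ᶠ δ in 𝓝[>] (0 : ℝ), ∀ Q : Measure (BondConfig (Site 2) × SiteConfig (Site 2)), Q.map Prod.fst = P2 → Q.map Prod.snd = PT → Q {p | ∃ i : Fin 2, (∃ u ∈ (bondLoopConfig δ 0 p.1).F i, u.range ⊆ Metric.ball (0 : ℂ) (1 / ε) ∧ ε / 8 ≤ Metric.diam u.range ∧ ∀ u' ∈ (siteLoopConfig δ p.2).F i, ε < u.udist u') ∨ (∃ u' ∈ (siteLoopConfig δ p.2).F i, u'.range ⊆ Metric.ball (0 : ℂ) (1 / ε) ∧ ε / 8 ≤ Metric.diam u'.range ∧ ∀ u ∈ (bondLoopConfig δ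 0 p.1).F i, ε < u'.udist u)} < ENNReal.ofReal (ε / 2) → LoopConfig.cnLawEDist P2 (bondLoopConfig δ 0) PT (siteLoopConfig δ) ≤ ENNReal.ofReal ε := by
  intro ε hε
  have hε4 : (0 : ℝ≥0∞) < ENNReal.ofReal (ε / 4) := ENNReal.ofReal_pos.2 (by positivity)
  have h2 : ∀ᶠ δ in 𝓝[>] (0 : ℝ), P2 {ω | ∃ z ∈ Metric.closedBall (0 : ℂ) (1 / ε), ∃ i : Fin 2,
      ∀ u ∈ (bondLoopConfig δ 0 ω).F i, ¬ u.range ⊆ Metric.ball z (ε / 4)} < ENNReal.ofReal (ε / 4) :=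
    (tendsto_order.1 (tendsto_measure_setOf_sparse_bondLoopConfig (1 / ε) (by positivity : 0 < ε / 4))).2
      _ hε4
  have hT : ∀ᶠ δ in 𝓝[>] (0 : ℝ), PT {ω | ∃ z ∈ Metric.closedBall (0 : ℂ) (1 / ε), ∃ i : Fin 2,
      ∀ u ∈ (siteLoopConfig δ ω).F i, ¬ u.range ⊆ Metric.ball z (ε / 4)} < ENNReal.ofReal (ε / 4) :=
    (tendsto_order.1 (tendsto_measure_setOf_sparse_siteLoopConfig (1 / ε) (by positivity : 0 < ε / 4))).2
      _ hε4
  filter_upwards [h2, hT] with δ hδ2 hδT Q hQ1 hQ2 hQ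
  refine LoopConfig.cnLawEDist_le_of_coupling hε Q hQ1 hQ2 ?_
  set Big : Set (BondConfig (Site 2) × SiteConfig (Site 2)) := {p | ∃ i : Fin 2,
      (∃ u ∈ (bondLoopConfig δ 0 p.1).F i, u.range ⊆ Metric.ball (0 : ℂ) (1 / ε) ∧
        ε / 8 ≤ Metric.diam u.range ∧ ∀ u' ∈ (siteLoopConfig δ p.2).F i, ε < u.udist u') ∨
      (∃ u' ∈ (siteLoopConfig δ p.2).F i, u'.range ⊆ Metric.ball (0 : ℂ) (1 / ε) ∧
        ε / 8 ≤ Metric.diam u'.range ∧ ∀ u ∈ (bondLoopConfig δ 0 p.1).F i, ε < u'.udist u)}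
    with hBig
  set S2 : Set (BondConfig (Site 2)) := {ω | ∃ z ∈ Metric.closedBall (0 : ℂ) (1 / ε), ∃ i : Fin 2,
      ∀ u ∈ (bondLoopConfig δ 0 ω).F i, ¬ u.range ⊆ Metric.ball z (ε / 4)} with hS2
  set ST : Set (SiteConfig (Site 2)) := {ω | ∃ z ∈ Metric.closedBall (0 : ℂ) (1 / ε), ∃ i : Fin 2,
      ∀ u ∈ (siteLoopConfig δ ω).F i, ¬ u.range ⊆ Metric.ball z (ε / 4)} with hST
  have hsub : {p : BondConfig (Site 2) × SiteConfig (Site 2) |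
      ¬ LoopConfig.IsClose ε (bondLoopConfig δ 0 p.1) (siteLoopConfig δ p.2)} ⊆
      (Big ∪ Prod.fst ⁻¹' S2) ∪ Prod.snd ⁻¹' ST := by
    intro p hp
    rcases bigUnmatched_or_sparse_of_not_isClose hε hp with h | h | h
    · exact Or.inl (Or.inl h)
    · exact Or.inl (Or.inr h)
    · exact Or.inr h
  have hfst : Q (Prod.fst ⁻¹' S2) < ENNReal.ofReal (ε / 4) := by
    refine (Measure.le_map_apply measurable_fst.aemeasurable S2).trans_lt ?_
    rw [hQ1]
    exact hδ2
  have hsnd : Q (Prod.snd ⁻¹' ST) < ENNReal.ofReal (ε / 4) := by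
    refine (Measure.le_map_apply measurable_snd.aemeasurable ST).trans_lt ?_
    rw [hQ2]
    exact hδT
  calc Q {p | ¬ LoopConfig.IsClose ε (bondLoopConfig δ 0 p.1) (siteLoopConfig δ p.2)}
      ≤ Q ((Big ∪ Prod.fst ⁻¹' S2) ∪ Prod.snd ⁻¹' ST) := measure_mono hsub
    _ ≤ Q (Big ∪ Prod.fst ⁻¹' S2) + Q (Prod.snd ⁻¹' ST) := measure_union_le _ _
    _ ≤ Q Big + Q (Prod.fst ⁻¹' S2) + Q (Prod.snd ⁻¹' ST) :=
        add_le_add (measure_union_le _ _) le_rfl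
    _ < ENNReal.ofReal (ε / 2) + ENNReal.ofReal (ε / 4) + ENNReal.ofReal (ε / 4) :=
        ENNReal.add_lt_add (ENNReal.add_lt_add hQ hfst) hsnd
    _ = ENNReal.ofReal ε := by
        rw [← ENNReal.ofReal_add (by positivity) (by positivity),
          ← ENNReal.ofReal_add (by positivity) (by positivity)]
        congr 1
        ring

end Summit.CriticalPhenomena.CardyFormulaZ2.Cruxes.NestingRigidity.MarkovCascadeOneGeneration

end
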